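import Mathlib
import HarnessLib
import HarnessLib.Audit
import Summits.AtomisticToContinuum.Statement
import HarnessLib.Audit.Status.Attr

/-!
Route: KnudsenRateHorizon

DORMANT since 2026-08-24T00:14:00Z (reconciler: no traction for 6.4 d (last activity item-evidence-added at 2026-08-17T14:51:42Z); parked, not closed — `ledger route dormant route-AtomisticToContinuum-KnudsenRateHorizon --off` to reacti) — unstaffed, not closed; items shared with open routes are served there. `ledger route dormant <id> --off` reactivates.

# Route KnudsenRateHorizon — Yau at Knudsen rate — H_N = O(N^(2/3)) pre-shock decides Euler;
N^(1/3)-rescaled entropy is Navier–Stokes dissipation; log N Ehrenfest horizon on the negative side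

X = EntropyKnudsenRateInBand ("it suffices to show"; the packing-guarded Knudsen-rate entropy bound,
re-typed 2026-08-16 together with
the conjunct, p126922): there is a packing threshold η₀ > 0 such that for all continuous
local-equilibrium profiles (a₀, u₀, θ₀) there is
σ₀ > 0 such that for every reduced density 0 < σ < σ₀, every classical hard-sphere Euler solution
(ρ, u, θ) on [0, T) WHOSE LOCAL PACKING
STAYS IN THE DILUTE BAND (ρ_t(x)σ³ < η₀ on [0,T) × 𝕋³ — verbatim the guard of the re-typed
Statement, at the Statement's position), every
family of hard-sphere flows Φ_N and every t < T there is a reference activity profile a (its local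
Gibbs law λ^N_t = localGibbsLaw σ a u_t θ_t
a probability measure whose empirical fields concentrate exponentially around (ρ, ρu, E)(t)) with
the KNUDSEN-RATE entropy bound
H((Φ_N,t)_* localGibbsLaw σ a₀ u₀ θ₀ | λ^N_t) ≤ C (N+1)^(2/3) = C·(N+1)·Kn_N, Kn_N = (N+1)^(-1/3),
for all N. This is Yau's relative-entropy
form of the (guarded) conjunct — the shared guarded node RelEntropyVanishingInBand,
stmt-AtomisticToContinuum-17396 (H = o(N) inside the band;
the canonical guarded twin of 0766 filed by route FluxGibbsianityLdDrude) — QUANTIFIED at the order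
Chapman–Enskog predicts (deviation from
local Gibbs at Euler parameters = the Navier–Stokes correction, relative size Kn). It realises card
knudsen-rate-law-and-ehrenfest-horizon
(spine): (Q1)/(Q5) = X; law (1)/(Q2) = crux KnudsenRateLaw; (2)/(Q3) = negative-side support
EhrenfestHorizon; (3) "rates, not o(N), are the
induction currency" is why X and not 17396 is the target. Conforming successor (D-0027 §2.1) of the
retired route KnudsenRate and, since the
Statement re-type, of this route's own unguarded target EntropyKnudsenRate (stmt-12339, dropped
2026-08-16: X_old = X plus the band along every
solution, i.e. it needed the implosion-exposed shared support DiluteSelfConsistency 3091 to be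
reached from the cruxes; the guard is now a
HYPOTHESIS of the conjunct, so the route no longer carries 3091 at all): X →
RelEntropyVanishingInBand (one line of ENNReal arithmetic, proved
inside `closes`) → `_root_.HydrodynamicLimit` (shared guarded dock EntropyToFieldsInBand,
stmt-17397, by name).
Lean: `∃ η₀ : ℝ, 0 < η₀ ∧ ∀ (a₀ θ₀ : Literature.MathematicalPhysics.KineticTheory.T3 → ℝ) (u₀ :
Literature.MathematicalPhysics.KineticTheory.T3 → Literature.MathematicalPhysics.KineticTheory.V3),
Continuous a₀ → Continuous θ₀ → Continuous u₀ → (∀ x, 0 < a₀ x) → (∀ x, 0 < θ₀ x) → ∃ σ₀ : ℝ, 0 < σ₀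
∧ ∀ σ : ℝ, 0 < σ → σ < σ₀ → ∀ (T : ℝ) (ρ θ : ℝ → Literature.MathematicalPhysics.KineticTheory.T3 →
ℝ) (u : ℝ → Literature.MathematicalPhysics.KineticTheory.T3 →
Literature.MathematicalPhysics.KineticTheory.V3),
Literature.MathematicalPhysics.KineticTheory.IsHardSphereEulerSolution σ T ρ u θ → (∀ t ∈ Set.Ico 0
T, ∀ x, ρ t x * σ ^ 3 < η₀) → ∀ Φ : (N : ℕ) → Literature.Analysis.FluidPDE.HardSphereFlow
(Literature.Analysis.FluidPDE.Torus.geometry (Fin 3))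
(Literature.MathematicalPhysics.KineticTheory.hsDiameter σ N) (N + 1), (∀ N,
MeasureTheory.IsProbabilityMeasure (Literature.MathematicalPhysics.KineticTheory.localGibbsLaw σ a₀
u₀ θ₀ N (Φ N))) ∧ (Literature.MathematicalPhysics.KineticTheory.TendstoHydroFieldsAt (fun N =>
Literature.MathematicalPhysics.KineticTheory.localGibbsLaw σ a₀ u₀ θ₀ N (Φ N)) Φ ρ u θ 0 → ∀ t ∈
Set.Ico 0 T, ∃ a : Literature.MathematicalPhysics.KineticTheory.T3 → ℝ, (∀ N,
MeasureTheory.IsProbabilityMeasure (Literature.MathematicalPhysics.KineticTheory.localGibbsLaw σ a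
(u t) (θ t) N (Φ N))) ∧ (∀ χ : Literature.MathematicalPhysics.KineticTheory.T3 → ℝ, Continuous χ → ∀
δ : ℝ, 0 < δ → ∃ C : ℝ, 0 < C ∧ ∀ N : ℕ, Literature.MathematicalPhysics.KineticTheory.localGibbsLaw
σ a (u t) (θ t) N (Φ N) {z | δ < |Literature.MathematicalPhysics.KineticTheory.empiricalDensityField
z χ - ∫ x, χ x * ρ t x|} ≤ ENNReal.ofReal (C * Real.exp (-(C⁻¹ * (N + 1)))) ∧
Literature.MathematicalPhysics.KineticTheory.localGibbsLaw σ a (u t) (θ t) N (Φ N) {z | δ <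
‖Literature.MathematicalPhysics.KineticTheory.empiricalMomentumField z χ - ∫ x, (χ x * ρ t x) • u t
x‖} ≤ ENNReal.ofReal (C * Real.exp (-(C⁻¹ * (N + 1)))) ∧
Literature.MathematicalPhysics.KineticTheory.localGibbsLaw σ a (u t) (θ t) N (Φ N) {z | δ <
|Literature.MathematicalPhysics.KineticTheory.empiricalEnergyField z χ - ∫ x, χ x *
Literature.MathematicalPhysics.KineticTheory.totalEnergyDensity (ρ t x) (u t x) (θ t x)|} ≤
ENNReal.ofReal (C * Real.exp (-(C⁻¹ * (N + 1))))) ∧ ∃ C : ℝ, ∀ N : ℕ, InformationTheory.klDiv ((Φ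
N).lawAt (Literature.MathematicalPhysics.KineticTheory.localGibbsLaw σ a₀ u₀ θ₀ N (Φ N)) t)
(Literature.MathematicalPhysics.KineticTheory.localGibbsLaw σ a (u t) (θ t) N (Φ N)) ≤
ENNReal.ofReal (C * ((N : ℝ) + 1) ^ (2 / 3 : ℝ)))`

## Assembly
`closes` certified, crux-only (rev 17, 2026-08-16): `theorem closes (h₀ : EntropyKnudsenRateInBand)
(h₂ : EntropyToFieldsInBand) : _root_.HydrodynamicLimit`
— the proof term turns X into the guarded Yau form RelEntropyVanishingInBand (shared crux 17396;
same η₀, same σ₀; the ENNReal squeeze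
klDiv ≤ ofReal(C(N+1)^(2/3)) ⟹ klDiv/(N+1) ≤ ofReal(max C 0·(N+1)^(-1/3)) → 0) and the shared
guarded entropy-inequality dock EntropyToFieldsInBand
(17397, crux until it lands as a Theorems lemma for this decl; in substance the landed
Theorems.hydroLimitInBand_of_relEntropyVanishingInBand /
tendstoHydroFieldsAt_of_klDiv) concludes the re-typed sub-problem decl `_root_.HydrodynamicLimit` BY
NAME — no `of_unguarded`, no iff.
Frame statement #1 Assembly := EntropyKnudsenRateInBand → _root_.HydrodynamicLimit (restated
2026-08-16; true via 17397, i.e. via `closes`).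
The cruxes feed X through the FILED glue KnudsenBandGlueInBand : MeanFieldKnudsenAccuracy →
EntropySaturationKnudsen → EntropyKnudsenRateInBand
(support rank 10; proved sorry-free in the repair planner's Sketch.lean with η₀ := ηs, the
saturation identity's band threshold, σ₀ := min of two)
and the foreseen layer-2 family KineticFluxRelaxation (+ remainder-form collisional half, Two-layer
plan) ⇒ MeanFieldKnudsenAccuracy;
KnudsenRateLaw → MeanFieldKnudsenAccuracy by the filed glue MeanFieldOfRateLaw (proved in the badge
planner's Sketch.lean); EhrenfestHorizon
(support) is the negative side and is used by neither `closes` nor any glue. Interim revs (same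
day): 11 = minimal repair `of_unguarded (EntropyToHydro (squeeze X_old))` over the unguarded spine;
12–16 = the
sequenced re-base (drops, adds, single-hypothesis closes via Theorems.tendstoHydroFieldsAt_of_klDiv,
Assembly restate, shared-node attach).

Rationale: WHY THIS LINE. Every open route of this sub-problem aims at the QUALITATIVE target H_N(t) = o(N)
(0766) or at field convergence; none states the order of
magnitude kinetic theory predicts, H_N(t)/N ≍ Kn_N = N^(-1/3) (one mean free path ℓ =
(√2πσ²)⁻¹N^(-1/3) in macroscopic units at fixed
reduced density; Spohn1991 Part I Ch. 3, ChapmanCowling1970 Ch. 16), and none is testable against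
molecular dynamics. By the exact
entropy-saturation identity (Liouville invariance of Shannon entropy + log-linearity of hard-sphere
local Gibbs laws in the empirical
measure + isentropy of smooth Euler flow; support EntropySaturationKnudsen) H_N(t)/(N+1) equals ONE
linear statistic Θ_N(t) of the expected
empirical fields up to O(N^(-1/3)), so X ⇔ "hydrodynamics holds IN THE MEAN to Navier–Stokes
precision" (crux MeanFieldKnudsenAccuracy),
whose kinetic content is "fast one-particle moments are in local equilibrium to O(Kn)" (crux
KineticFluxRelaxation, the Boltzmann-hypothesis
step WITH A RATE), and whose sharp form is the second-order law N^(1/3)Θ_N(t) → ∫₀ᵗ∫[η|S(u)|²/2θ +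
ζ(div u)²/θ + κ|∇θ|²/θ²] evaluated on the
EULER solution (crux KnudsenRateLaw: relative entropy now = Navier–Stokes entropy production later,
in Knudsen units). Imported areas:
kinetic theory of moderately dense gases (Enskog/Green–Kubo transport: ChapmanCowling1970,
Dorfman1999, EvansMorriss2008) for the constants;
quantitative hydrodynamic limits by consistency–stability for stochastic lattice gases
(arXiv:2212.00079, arXiv:2412.16714, arXiv:2404.12234)
as the model of a rate-first target; Navier–Stokes corrections to hydrodynamic limits
(Esposito–Marra–Yau doi:10.1142/s0129055x94000444,
doi:10.1007/bf02517896; De Masi–Esposito–Lebowitz doi:10.1002/cpa.3160420810; KipnisLandim1999 Ch.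
7) for the form of the law; hydrodynamic
stability (MeshalkinSinai1961, Belenkaya–Friedlander–Yudovich doi:10.1137/s0036139997327575) and
Euler-scale fluctuation theory (Spohn1991
§7.1 (7.28); MD instabilities seeded by thermal noise, Kadau et al. doi:10.1073/pnas.0401228101,
Bandak–Goldenfeld–Mailybaev–Eyink
doi:10.1103/physreve.105.065113) for the negative side. What it does that prior routes and the
negatives index do not: a polynomial rate
self-iterates under Gronwall/restarts where o(N) does not (H_N(s+τ) ≤ e^(Cτ)H_N(s) + C'N^(2/3)τ),
every item is an MD-falsifiable number,
and the log N horizon says where ANY growing-time strengthening must fail although the Euler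
solution is global and smooth.

RANKED CRUXES. #0 EntropyKnudsenRateInBand (target X; crux rank 0 — hypothesis of `closes`; added
2026-08-16 by the re-type repair as the packing-guarded twin of the dropped unguarded X_old =
EntropyKnudsenRate 12339) — X as in § Thesis — the 17396-shaped statement (∃ η₀ outermost, guard
ρ_tσ³ < η₀ on [0,T) after the solution hypothesis) whose conclusion is ∃ a (probability, exponential
concentration of the reference fields around (ρ,ρu,E)(t)) ∧ ∃ C ∀ N, klDiv(lawAt Φ_N (localGibbs
a₀u₀θ₀) t ‖ localGibbs a u_t θ_t) ≤ C (N+1)^(2/3). Card items (Q1)/(Q5). Cruxes 2–4 keep the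
unguarded prefix of X_old (they quantify over every classical solution; stronger hypotheses for the
glue, see Not decomposed yet). (why it might fail: Strictly stronger than the guarded conjunct: if
local equilibrium is reached only at an anomalous algebraic rate slower than Kn = N^(-1/3) (e.g.
N^(-1/6)), 17396 holds and X fails; inherits the Boltzmann-hypothesis and large-velocity
obstructions of 0766/17396.) [Yau1991, OllaVaradhanYau1993, KipnisLandim1999, Spohn1991,
arXiv:2212.00079]
#2 KineticFluxRelaxation (crux) — LOCAL EQUILIBRIUM OF THE FAST MOMENTS AT KNUDSEN PRECISION
(kinetic half of the quantitative one-block estimate): under the hypotheses of X, for t < T, every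
smooth test function χ and components j,k, the time-integrated expected empirical kinetic stress
(N+1)⁻¹Σ χ(x_i) v_i,j v_i,k and kinetic energy flux (N+1)⁻¹Σ χ(x_i) v_i,j|v_i|²/2 along the
deterministic evolution differ from their local-Maxwellian values at the Euler state, ∫χρ_s(u_s,j
u_s,k + θ_s δ_jk) and ∫χ(E_s + ρ_sθ_s)u_s,j, by at most C (N+1)^(-1/3) (the size of the viscous
stress / heat flux). Engine cards chapman-enskog-corrector / kinetic-windows-inside-yau would
deliver it; collisional half: Not decomposed yet. [difficulty: open-problem] (why it might fail:
Needs an N-uniform relaxation RATE for the linearised hard-sphere collision dynamics at fixed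
density plus recollision control — the Boltzmann-hypothesis step with a rate, unproved for any
deterministic interacting system; the cubic energy flux needs LargeVelocityControl-type input.)
[Yau1991, OllaVaradhanYau1993, Spohn1991, Grad1963, ChapmanCowling1970, VanbeijerenErnst1973]
#3 MeanFieldKnudsenAccuracy (crux) — HYDRODYNAMICS IN THE MEAN TO NAVIER–STOKES PRECISION (card (Q1)
in its MD-measurable form): under the hypotheses of X, for t < T there is a positive reference
activity a (probability + exponential concentration clauses as in X) and C with Θ_N(t) ≤ C
(N+1)^(-1/3) for all N, where Θ_N(t) = E_λ⟨emp, g_t⟩ − E⟨emp(Φ_N,t z), g_t⟩, g_t = log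
localGibbsProfile a u_t θ_t = (log a − 3/2·log 2πθ_t − |u_t|²/2θ_t) + v·u_t/θ_t − |v|²/2θ_t: five
expected empirical fields paired with the Euler conjugate variables; one-sided suffices (Θ_N ≥
−O(N^(-2/3)) from H ≥ 0). With EntropySaturationKnudsen it implies X (η₀ := ηs): filed glue
KnudsenBandGlueInBand (rank 10, proved in the repair planner's sketch; the band is now a hypothesis
of X, so DiluteSelfConsistency 3091 is no longer wanted by this route). [deps:
KineticFluxRelaxation] [difficulty: open-problem] (why it might fail: If hydrodynamics holds in the
mean only with o(1) but not O(Kn) error (anomalous relaxation, cf. the N^(-1/6) Lagrangian-coherence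
rate) this fails while 0766 survives; for large T compressive smooth solutions can leave the dilute
EOS regime at fixed σ (implosion loophole).) [OllaVaradhanYau1993, KipnisLandim1999, Spohn1991,
arXiv:2412.16714, Yau1991]
#4 KnudsenRateLaw (crux) — THE SECOND-ORDER LAW (card law (1)/(Q2)): there are continuous
coefficient functions η, ζ, κ of (σ; ρ, θ), η, κ > 0, ζ ≥ 0 (hard-sphere shear/bulk viscosity and
heat conductivity in Knudsen units — existence claimed, no density expansion, no Enskog values),
universal over profiles, solutions and flows, such that under the hypotheses of X, for t < T:
(N+1)^(1/3)·Θ_N(t) → ∫₀ᵗ∫_𝕋³ [η|S(u)|²/(2θ) + ζ(div u)²/θ + κ|∇θ|²/θ²](s,x) dx ds, S(u) = ∇u + ∇uᵀ −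
(2/3)(div u)𝟙, evaluated on the EULER solution: Yau's entropy per particle, magnified by Kn⁻¹,
converges to the Navier–Stokes entropy production the Euler flow would have. → crux 3 by the filed
glue MeanFieldOfRateLaw (a convergent sequence is bounded; sharp constant and matching lower bound);
it is the statement event-driven MD tests. [deps: MeanFieldKnudsenAccuracy] [difficulty:
open-problem] (why it might fail: Requires compressible Navier–Stokes corrections IN THE MEAN for
deterministic hard spheres (open even with noise: only incompressible NS is derived for stochastic
lattice gases, Esposito–Marra–Yau); at fixed σ mode-coupling terms O(Kn^(3/2)) sit close to the
O(Kn) signal.) [Spohn1991, doi:10.1007/bf02517896, doi:10.1002/cpa.3160420810, KipnisLandim1999,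
Dorfman1999, EvansMorriss2008, arXiv:1512.02679]
#5 EhrenfestHorizon (support) — NEGATIVE SIDE, THE log N HORIZON (card (2)/(Q3); seed for a Barriers
growing-horizon entry): ∃ A, θ₀, σ₀ > 0 such that for σ < σ₀ and every flow family, for the
Kolmogorov local Gibbs data (a ≡ 1, u₀ = A sin(4πx₁)e₀, θ ≡ θ₀; steady smooth Euler, support
KolmogorovSteady) some continuous χ and δ, c, C > 0 give, for infinitely many N, P_N(‖momentum
field(Φ_N,t_N z)(χ) − ∫χu₀‖ > δ) ≥ c at t_N = C log(N+2). Heuristic: the inviscidly unstable k = 1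
mode grows from thermal amplitude N^(-1/2) to O(1) at (2γ)⁻¹ log N. Outside the conjunct, on no glue
path — hence support (review S2(d)). [MeshalkinSinai1961, doi:10.1137/s0036139997327575, Spohn1991,
doi:10.1073/pnas.0401228101, doi:10.1103/physreve.105.065113]
#9 EntropySaturationKnudsen (support) — QUANTITATIVE ENTROPY-SATURATION IDENTITY, band-guarded
ENNReal form (stmt-14322; restated 2026-08-16 by the badge repair from the rev-0 C²/toReal form
12344): ∃ ηs > 0 (a packing threshold inside the cluster-expansion / HsEosLowDensity radius) such
that under the hypotheses of X, for t < T, IF ρ_sσ³ < ηs on [0,t] × 𝕋³, THEN for EVERY positive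
reference activity a whose local Gibbs law (a, u_t, θ_t) is a probability measure with fields
concentrating exponentially around (ρ,ρu,E)(t): ∃ C ∀ N, ofReal((N+1)(Θ^a_N(t) − C(N+1)^(-1/3))) ≤
klDiv(lawAt Φ_N P_N t ‖ λ^a_t) ≤ ofReal((N+1)(Θ^a_N(t) + C(N+1)^(-1/3))) — H_N(t) is finite and
|H_N/(N+1) − Θ^a_N| ≤ C(N+1)^(-1/3). Sketch: H = S(λ^a_t) − S(P_N) + (N+1)Θ^a_N(t) exactly
(Liouville; log-linearity of local Gibbs laws in the empirical measure; finiteness from lawAt ≪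
λ^a_t and energy conservation), S(localGibbs)/(N+1) by the inhomogeneous cluster expansion inside
the band (tree: hsEosLowDensity_proof), isentropy of classical hs-Euler solutions. [difficulty: L]
[Yau1991, Ruelle1969, LebowitzPenrose1964, SaintRaymond2009, Spohn1991]
#9 KolmogorovSteady (support) — the Kolmogorov shear data of EhrenfestHorizon is an exact steady
classical hard-sphere Euler solution for every σ, T and θ₀ > 0: ρ ≡ 1, u(x) = A sin(4π x₁) e₀, θ ≡
θ₀ (div u = 0, (u·∇)u = 0, p constant; smoothness of x ↦ sin(4π·repr(x)₁) on the torus, period 1/2).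
Puts the horizon data inside the conjunct's hypothesis class (T = ∞). [difficulty: provable-now]
[MeshalkinSinai1961, Spohn1991]
#9 RelEntropyVanishingInBand (crux rank 9: named by the closes-hypothesis EntropyToFieldsInBand,
cruxes render above supports, lower id renders first) — shared item stmt-AtomisticToContinuum-17396,
the CANONICAL packing-guarded twin of Yau's target 0766 (0766 verbatim + the Statement's guard at
its position, ∃ η₀ prefixed; filed by FluxGibbsianityLdDrude for re-basing entropy routes to attach
to): ∀ t < T ∃ a_t with the reference local Gibbs law a probability measure concentrating
exponentially around (ρ,ρu,E)(t) and klDiv(lawAt Φ_N P_N t ‖ λ^N_t)/(N+1) → 0, for band-respecting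
solutions. The node through which X reaches the Statement (X ⇒ 17396 with the same η₀, σ₀ by the
ENNReal squeeze, proved inline in `closes`); not itself a hypothesis of `closes`. Replaces 0766 +
12346 of revs 0–11. [difficulty: open-problem] [Yau1991, OllaVaradhanYau1993, KipnisLandim1999,
Spohn1991]
#9 EntropyToFieldsInBand (crux rank 9: the one hypothesis of `closes` besides X — gate rule
glue.non-crux-hypothesis — until a Theorems file states it for this decl; provable now) — shared
guarded dock stmt-AtomisticToContinuum-17397: RelEntropyVanishingInBand → `_root_.HydrodynamicLimit`
BY NAME (take η₀, σ₀ from the hypothesis; at each t < T the landed entropy-inequality step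
Theorems.tendstoHydroFieldsAt_of_klDiv — μ(A)·L ≤ KL(μ‖ν) + (e^L − 1)ν(A), reference concentration,
transfer along the measurable flow; equivalently
Theorems.hydroLimitInBand_of_relEntropyVanishingInBand + the two registered iff's). Replaces the
unguarded 0769 (proved, Theorems.heatBathForgetting_assembly_proof; dropped from this route with its
`of_unguarded` bridge of rev 11). [difficulty: S] [KipnisLandim1999, OllaVaradhanYau1993, Yau1991]

#9 MeanFieldOfRateLaw (support; badge repair 2026-08-16, provable now — proved sorry-free in the
planner's Sketch.lean) — KnudsenRateLaw → MeanFieldKnudsenAccuracy: same prefix and reference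
clauses verbatim; (N+1)^(1/3)Θ^a_N(t) → L is bounded above (Filter.Tendsto.bddAbove_range), so
Θ^a_N(t) ≤ B(N+1)^(-1/3) (Real.rpow_neg, le_div_iff₀). Makes crux 4 an entrance to X through
KnudsenBandGlueInBand. [difficulty: provable-now] [Spohn1991, KipnisLandim1999]
#10 KnudsenBandGlueInBand (support, rank 10: renders after the rank-9 supports it quotes) —
MeanFieldKnudsenAccuracy → EntropySaturationKnudsen → EntropyKnudsenRateInBand: the crux → target
glue of the re-typed route, PROVED sorry-free in the repair planner's sketch
(knudsenBandGlueInBand_proof, standard axioms, verbatim rev-11 decls): η₀ := ηs from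
EntropySaturationKnudsen, σ₀ := min of the two σ₀'s (crux 3, 14322); for σ < σ₀, a guarded solution
and t < T take the crux-3 witness a (a > 0, probability, concentration, Θ^a_N(t) ≤ C₁(N+1)^(−1/3));
the Statement-shaped guard on [0,T) gives 14322's band on [0,t]; 14322 gives klDiv ≤
ofReal((N+1)(Θ^a_N + C₂(N+1)^(−1/3))) ≤ ofReal((C₁+C₂)(N+1)^(2/3)). Supersedes KnudsenBandGlue 14616
(… → DiluteSelfConsistency → X_old), dropped with 3091. [difficulty: provable-now] [Yau1991,
KipnisLandim1999]

TWO-LAYER PLAN. Layer 1 wired 2026-08-16: X ⇐ crux 3 by KnudsenBandGlueInBand (re-type repair lane;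
formerly KnudsenBandGlue through 3091), crux 4 ⇒ crux 3 by MeanFieldOfRateLaw (badge lane). Foreseen
glued split (unfiled; tenure): MeanFieldKnudsenAccuracy ⇐ KineticFluxRelaxation →
CollisionalFluxRelaxation → StaticMeanRate → MeanFieldKnudsenAccuracy (k = 3), where
CollisionalFluxRelaxation bounds by C(N+1)^(-1/3) the expected PATHWISE REMAINDER of the
momentum/energy balance, E[⟨m_N(t),χ⟩_k − ⟨m_N(0),χ⟩_k − ∫₀ᵗ⟨emp_s,(v·∇χ)v_k⟩ds] − ∫₀ᵗ∫(p − ρθ)∂_kχ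
(energy: (p − ρθ)u·∇χ) — typable without a contact-current definition (cf. 9259) — and
StaticMeanRate is the O((N+1)^(-1/3)) law of large numbers IN THE MEAN for P_N and λ^a_t (cluster
expansion). Since crux 2 is stated against the Euler solution itself, Θ_N(t) = Σ_fields⟨E_λ −
E_{μ_t}, conjugate variable⟩ closes by bookkeeping without Gronwall, but needs crux-2-type constants
UNIFORM in s ≤ t (crux 2 gives one C per t): the split carries the uniform-in-s form as the child,
crux 2 staying claimable directly. KnudsenRateLaw ⇐ NSCorrectionInMean (E U_N = U^E + Kn U¹ + o(Kn))
→ EntropyBalance (S_macro(U^E + KnU¹) − S_macro(U₀) = Kn∫∫σ_s + o(Kn)) → KnudsenRateLaw (k = 2).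
Headroom 12/15 (drop EhrenfestHorizon + KolmogorovSteady first if more is needed).

KILL CRITERIA. MD or theory showing N^(1/3)Θ_N(t) DRIFTS with N at fixed pre-shock t (e.g. grows
like N^(1/6)) refutes MeanFieldKnudsenAccuracy and X together:
close `refuted:MeanFieldKnudsenAccuracy` (the conjunct and 17396 survive; the card's "anomalous
second-order law" becomes a new card). A bounded
but NON-convergent or non-Navier–Stokes limit refutes KnudsenRateLaw only — drop it, keep X.
¬KineticFluxRelaxation with MeanFieldKnudsenAccuracy
intact is impossible at O(Kn) bookkeeping (O(1) non-equilibrium stresses with NS-accurate means) —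
such a refutation signals a misstatement;
restate as a new item. EhrenfestHorizon refuted (uniform-in-log-time convergence for Kolmogorov
data) does not touch `closes`; EhrenfestHorizon
PROVED is a barrier entry, not a kill. 17396 refuted pre-shock INSIDE the band (entropy production ≥
cN for smooth dilute data) closes this route and every
relative-entropy route at once (the squeeze inside `closes` then gives ¬X); an implosion-type
witness against the unguarded prefix of cruxes 2–4 is a
MISSTATEMENT kill (repair = their guarded twins, Not decomposed yet). 17396 or EntropyToFieldsInBand
proved elsewhere moot the corresponding
items but not cruxes 2–4; HydrodynamicLimit proved elsewhere moots the route as an entrance, not the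
rate law.

NOT DECOMPOSED YET. The split of crux 3 just described (remainder-form collisional twin of crux 2,
uniform-in-s crux 2, static mean rate) — unfiled until crux 2 or 3 moves; the block (one-block) form
of the flux relaxation; the constants η, ζ, κ (Enskog values ± ring corrections — existential in
crux 4, see NoDensityExpansion); packing-guarded twins of cruxes 2–4 (they keep the ∀-solution
prefix of X_old; insert the Statement's guard after the solution hypothesis, glue unchanged with η₀
:= min — filed only if an implosion-type witness threatens the unguarded forms: repair, not
retirement; the twin of X itself IS the target since the re-type repair); the lower bound liminf
N^(1/3)Θ_N > 0 for data with S(u₀) ≠ 0 (inside crux 4); the d = 2 analogue (card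
entropy-loss-and-2d-litmus); the stable-data horizon t_N ~ N^(1/3) and any uniform-horizon positive
statement. All are layer-2 children or other routes.

CHEAPEST FALSIFIER. Event-driven hard-sphere MD (kit compute; packing 0.05–0.1, N = 10⁴…10⁶, ≥ 10³
local-Gibbs samples): (i) decaying sound wave / Taylor–Green
vortex: N^(1/3)Θ_N(t) (ensemble mean of ONE explicit additive observable, no entropy estimation)
against ∫₀ᵗ∫σ_s[U^E] with Enskog η, ζ, κ — an
N-drift at fixed t kills crux 3 and X, a wrong but N-stable curve kills only crux 4; (ii) Kolmogorov
flow u₀ = A sin 4πy: departure time of the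
k_x = 1 momentum mode vs log N (slope (2γ)⁻¹?) — no growth with N, or polynomial growth,
kills/changes the support EhrenfestHorizon. Not run yet (kit jobs for the first refuter/kit unit).
Lookups: rates exist only for stochastic lattice gases (arXiv:2212.00079, arXiv:2412.16714,
arXiv:2404.12234); nothing in print kills or proves X cheaply. Lean-side audit done here: every ∃C∀N
clause
absorbs small N; at t = 0 and for global/boosted equilibria a = a₀ gives Θ_N ≡ 0 (Gibbs invariance),
so cruxes 3–4 have no degenerate instance;
`HardSphereFlow` pins the elastic dynamics on a conull good set, so ∀Φ offers no exotic witness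
against crux 5.

NUMBERS. Kn_N = ℓ/L = (√2 π σ²)⁻¹ (N+1)^(-1/3) (Boltzmann mean free path at reduced diameter σ;
Enskog: divide by the contact value χ(φ)); Enskog
hard-sphere transport at packing φ = πρσ³/6: η_E/η₀ = 1/χ + 0.8 b₂ρ + 0.761 (b₂ρ)²χ, κ_E/κ₀ = 1/χ +
1.2 b₂ρ + 0.755 (b₂ρ)²χ, ζ_E/η₀ = 1.002 (b₂ρ)²χ
with b₂ρ = 4φ, η₀ = (5/16σ²)√(θ/π), κ₀ = (75/64σ²)√(θ/π) (ChapmanCowling1970 Ch. 16; Dorfman1999);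
ring/long-time-tail corrections to η at φ ≤ 0.1 are a few % (EvansMorriss2008 Ch. 1;
Alder–Wainwright tails t^(-3/2) integrable in d = 3: the O(Kn) order is not renormalised; next order
Kn^(3/2) = N^(-1/2)). Horizon: thermal seed N^(-1/2), inviscid Kolmogorov growth rate γ = O(2πA) for
k = 1 < 2 (BFY 1999),
t_N = (2γ)⁻¹ log N; stable data: t_N ≳ N^(1/3)/k². Items: 11 at open; 14 after the 2026-08-16
badge/choice repairs; 12 after the re-type repair (X + 3 ranked cruxes 2–4 + the two rank-9
closes-side shared cruxes 17396/17397, 5 support, 1 assembly).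

DEFINITION REQUESTS. None needed to STATE the items (all twelve elaborate over
Literature.MathematicalPhysics.KineticTheory.*, Literature.Analysis.FluidPDE.* and the torus
calculus). `hsContactCurrent` (collisional transfer as a flux-weighted trace on the collision
boundary; shared with 0782) is convenient but not required for the split of crux 3 (remainder form).
Barrier-candidate (cite fact, once EhrenfestHorizon is graded): long-wave instability of inviscid
Kolmogorov flow sin(my), k < m (Belenkaya–Friedlander–Yudovich doi:10.1137/s0036139997327575) as the
kernel of a `Literature/Barriers/AtomisticToContinuum` growing-horizon entry.

CONE AUDIT (cone lane 2026-08-15, re-checked 2026-08-16). needs-fact: NONE. The unproved named facts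
in the IMPORT cone are the summit's open conjunct statements imported by the operator Statement
files (route `imports: []`); no item rests on them; gate deps 0 unproved. REPAIRS 2026-08-16: (i)
review S2 (rchoice 0139634d + rbadge 6480f909): 14322 band-guarded ENNReal form, 14616, 14637,
EhrenfestHorizon → support, crux-only `closes` rev 9; (ii) STATEMENT RE-TYPE p126922 (lane rrepair
50332292): rev 11 minimal re-elaboration (`_root_.HydrodynamicLimit.of_unguarded ∘ EntropyToHydro ∘
squeeze`), revs 12–17 guarded re-base — + EntropyKnudsenRateInBand (X), + 17396/17397 (attached
shared guarded Yau node and dock), + KnudsenBandGlueInBand, Assembly restated to X → Statement; −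
12339 X_old, − 12346 KnudsenImpliesVanishing, − 0766, − 0769 (proved; off-path), − 14616
KnudsenBandGlue, − 3091 DiluteSelfConsistency (the band is a hypothesis of the conjunct now, so the
implosion-exposed σ-uniform density bound leaves the deciding chain); imports back to []; `closes`
(h₀ : X) (h₂ : EntropyToFieldsInBand) : _root_.HydrodynamicLimit, Sketch.lean/Sketch2.lean rc 0,
axioms standard. 12 items.

Novelty: Searches (2026-08-15, this seat): `lit search --hybrid "Navier-Stokes correction relative entropy
hydrodynamic limit rate of convergence"` (12
held books: KipnisLandim1999 pp. 3/112/118/186, SaintRaymond2009, Cercignani–Illner–Pulvirenti 1994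
— nothing quantitative for Hamiltonian
systems); `lit search --source zbmath "hydrodynamic limit rate of convergence relative entropy"` (3:
arXiv:2412.16714 the only relevant);
`lit search --source crossref "Navier-Stokes corrections hydrodynamic limit relative entropy"` (10,
none on particle systems); `lit galaxy search
"Navier-Stokes correction" --star all` (12: DeMasi–Presutti LNM 1501, Kipnis–Landim, Ferrari–Olla
hard-rod diffusive fluctuations — stochastic or
integrable second-order corrections only); `lit galaxy search "Ehrenfest time" --star all` (24, all
quantum-chaos/semiclassics — the term is
unused for hydrodynamic-limit horizons); four longer galaxy phrases 0 hits; `lit frontier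
AtomisticToContinuum --since 2023` (30: arXiv:2404.12234
quantitative nongradient exclusion, arXiv:2310.13338 heat equation from deterministic dynamics, JSP
2026 binary-collision fluctuations — no rate
for hard spheres); `lit bridges AtomisticToContinuum --cross any` (30, none relevant);
arXiv/OpenAlex/S2 remotes rate-limited (HTTP 429) this
session; plus the g1 seat's 14 zbmath/crossref queries recorded in Theses/KnudsenRate.lean (same
day).
Nearest prior art found: arXiv:2212.00079 and arXiv:2412.16714 (Menegaki–Mouhot–Marahrens
consistency–stabilit  [refs: 10.1142/s0129055x94000444, 10.1007/bf02517896, 10.1137/s0036139997327575, 10.1073/pnas.0401228101, 10.1103/physreve.105.065113, 2412.16714, 2404.12234, 2310.13338, 2212.00079, doi:10.1142/s0129055x94000444, doi:10.1007/bf02517896, doi:10.1137/s0036139997327575, doi:10.1073/pnas.0401228101, doi:10.1103/physreve.105.065113, KipnisLandim1999, SaintRaymond2009, Spohn1991, MeshalkinSinai1961]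

Barriers (technique_class: relative-entropy knudsen-rate instability-horizon): - technique_class: relative-entropy knudsen-rate instability-horizon
- Literature.Barriers.AtomisticToContinuum.BoltzmannHypothesisBarrier: it does not evade it; the bet
is that the closure input is needed only in the MEAN and with a RATE (crux KineticFluxRelaxation:
fast moments relax within O(1) collision times, i.e. O(Kn) macroscopic time), which is where the
engine cards attack; this route changes the FORM of the target (rate, one linear statistic), not the
ergodic input, and says so.
- Literature.Barriers.AtomisticToContinuum.HighMomentumCutoffBarrier: inherited — the kinetic energy
flux in crux 2 is cubic in v and the true kinetic energy cannot be modified; the target X, cruxes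
3–4 and the saturation identity involve only QUADRATIC velocity statistics (g_t = λ⁰ + λ·v −
|v|²/2θ_t), so the target itself needs no cubic exponential moments.
- Literature.Barriers.AtomisticToContinuum.HighMomentumCutoffBarrierNarrow: it does not evade it for
crux KineticFluxRelaxation — the convective kinetic energy flux Σχ(x_i)v_i|v_i|²/2 is exactly the
cubic current whose entropy-inequality control fails against Gaussian references; the bet is the new
a-priori input named there (LargeVelocityControl-type propagation of velocity moments by the
collision dynamics, card apriori-tails-and-rattlers / route ExpTailStaging).
- Literature.Barriers.AtomisticToContinuum.ShockFormationBarrier: not met — every positive item is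
pre-shock at fixed t < T with the smooth reference; EhrenfestHorizon conject

History (route lifecycle, newest last):
- 2026-08-15T21:16:31Z · rev 1: restated Assembly (stmt-AtomisticToContinuum-12347) — route-repair (ground-failed): Assembly (stmt-12347) was the tautology EntropyKnudsenRate → KnudsenImpliesVanishing → EntropyToHydro → HydrodynamicLimit, flagged (planner-rground-AtomisticToContinuum-KnudsenRat-6480f909-0)
- 2026-08-16T03:58:32Z · rev 5: dropped stmt-AtomisticToContinuum-14470, stmt-AtomisticToContinuum-14302, stmt-AtomisticToContinuum-14308 — route-choice (a), step 1 of 2: drop the rank-9 glue KnudsenSaturationGlue (14470; rendered BLOCKED above the shared item 3091 because rank-9 items render in id- (planner-rchoice-AtomisticToContinuum-KnudsenRa-0139634d-0)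
- 2026-08-16T04:03:35Z · AUTO-CRUX (edit): EntropyKnudsenRate — hypotheses of the deciding theorem that nothing in the route derives are cruxes (planner-rchoice-AtomisticToContinuum-KnudsenRa-0139634d-0)
- 2026-08-16T23:35:21Z · rev 12: dropped KnudsenBandGlue, DiluteSelfConsistency, KnudsenImpliesVanishing — route-repair (statement-revised p126922) step 2a/6 — guarded re-base, drops first (cap accounting): drop the supports of the unguarded crux→target path that the (planner-rrepair-AtomisticToContinuum-KnudsenRa-50332292-0)
- 2026-08-16T23:42:59Z · rev 15: restated Assembly (stmt-AtomisticToContinuum-13788) — route-repair (statement-revised p126922) step 2d/6 — guarded re-base: restate the frame statement Assembly 1:1 to `EntropyKnudsenRateInBand → _root_.Hydrodynami (planner-rrepair-AtomisticToContinuum-KnudsenRa-50332292-0)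
- 2026-08-16T23:42:59Z · rev 15: dropped EntropyKnudsenRate, RelEntropyVanishing, EntropyToHydro — route-repair (statement-revised p126922) step 2d/6 — guarded re-base: restate the frame statement Assembly 1:1 to `EntropyKnudsenRateInBand → _root_.Hydrodynami (planner-rrepair-AtomisticToContinuum-KnudsenRa-50332292-0)
- 2026-08-24T00:14:00Z · DORMANT — reconciler: no traction for 6.4 d (last activity item-evidence-added at 2026-08-17T14:51:42Z); parked, not closed — `ledger route dormant route-AtomisticToConti (operator:999:1224976)

sub-problem: HydrodynamicLimit · status: dormant · opened planner-plancard-AtomisticToContinuum-Hydrody-bfad0257-g2-0 2026-08-15T18:53:23Z · rev 17 · ledger route-AtomisticToContinuum-KnudsenRateHorizon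
GENERATED by the gate from the ledger (D-0016/17). Provers cite these decls: `theorem foo : Summit.AtomisticToContinuum.HydrodynamicLimit.Theses.KnudsenRateHorizon.<Decl> := …` in Summits/AtomisticToContinuum/HydrodynamicLimit/Theorems/<Name>.lean.
-/

namespace Summit.AtomisticToContinuum.HydrodynamicLimit.Theses.KnudsenRateHorizon

open scoped BigOperators Topology Manifold Classical MeasureTheory ProbabilityTheory Matrix InnerProductSpace ComplexConjugate ContinuousMap
open Filter Set Function TopologicalSpace MeasureTheory

attribute [summit_statement] _root_.HydrodynamicLimit

/-- item stmt-AtomisticToContinuum-17776 · crux · rank 0 · open · by planner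
why it might fail: Strictly stronger than the guarded conjunct: if local equilibrium is reached only at an anomalous algebraic rate slower than Kn = N^(-1/3) (e.g. N^(-1/6)), 17396 holds and X fails; inherits the Boltzmann-hypothesis and large-velocity obstructions of 0766/17396.
sources: Yau1991, OllaVaradhanYau1993, KipnisLandim1999, Spohn1991, arXiv:2212.00079
[target] PACKING-GUARDED X (re-type repair 2026-08-16, p126922): there is η₀ > 0 such that for all
continuous positive profiles ∃ σ₀ ∀ 0<σ<σ₀ ∀ T ∀ classical hs-Euler solutions (ρ,u,θ) on [0,T) WHOSE
LOCAL PACKING STAYS BELOW η₀ (ρ_t(x)σ³ < η₀ on [0,T) × 𝕋³, the Statement's guard at the Statement's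
position) ∀ flow families Φ: the initial local Gibbs laws are probability measures and, if their
empirical fields converge at t = 0, then ∀ t < T ∃ a reference activity a (local Gibbs law (a, u_t,
θ_t) a probability measure, fields concentrating exponentially around (ρ,ρu,E)(t)) with the
KNUDSEN-RATE entropy bound klDiv(lawAt Φ_N (localGibbs a₀u₀θ₀) t ‖ localGibbs a u_t θ_t) ≤ C
(N+1)^(2/3) = C(N+1)Kn_N for all N. Canonical guarded form: the dropped unguarded X_old (stmt-12339)
verbatim with the guard inserted and `∃ η₀ : ℝ, 0 < η₀ ∧` prefixed; its prefix is
character-identical to the shared guarded Yau node RelEntropyVanishingInBand (17396), which it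
implies with the same η₀, σ₀ by the ENNReal squeeze (inline in `closes`). Reached from crux 3 by
KnudsenBandGlueInBand with η₀ := ηs (no DiluteSelfConsistency). Card items (Q1)/(Q5). [deps:
MeanFieldKnudsenAccuracy, EntropySaturationKnudsen -/
@[route_item "route-AtomisticToContinuum-KnudsenRateHorizon", crux]
def EntropyKnudsenRateInBand : Prop :=
  ∃ η₀ : ℝ, 0 < η₀ ∧ ∀ (a₀ θ₀ : Literature.MathematicalPhysics.KineticTheory.T3 → ℝ) (u₀ : Literature.MathematicalPhysics.KineticTheory.T3 → Literature.MathematicalPhysics.KineticTheory.V3), Continuous a₀ → Continuous θ₀ → Continuous u₀ → (∀ x, 0 < a₀ x) → (∀ x, 0 < θ₀ x) → ∃ σ₀ : ℝ, 0 < σ₀ ∧ ∀ σ : ℝ, 0 < σ → σ < σ₀ → ∀ (T : ℝ) (ρ θ : ℝ → Literature.MathematicalPhysics.KineticTheory.T3 → ℝ) (u : ℝ → Literature.MathematicalPhysics.KineticTheory.T3 → Literature.MathematicalPhysics.KineticTheory.V3), Literature.MathematicalPhysics.KineticTheory.IsHardSphereEulerSolution σ T ρ u θ → (∀ t ∈ Set.Ico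 0 T, ∀ x, ρ t x * σ ^ 3 < η₀) → ∀ Φ : (N : ℕ) → Literature.Analysis.FluidPDE.HardSphereFlow (Literature.Analysis.FluidPDE.Torus.geometry (Fin 3)) (Literature.MathematicalPhysics.KineticTheory.hsDiameter σ N) (N + 1), (∀ N, MeasureTheory.IsProbabilityMeasure (Literature.MathematicalPhysics.KineticTheory.localGibbsLaw σ a₀ u₀ θ₀ N (Φ N))) ∧ (Literature.MathematicalPhysics.KineticTheory.TendstoHydroFieldsAt (fun N => Literature.MathematicalPhysics.KineticTheory.localGibbsLaw σ a₀ u₀ θ₀ N (Φ N)) Φ ρ u θ 0 → ∀ t ∈ Set.Ico 0 T, ∃ a : Literature.MathematicalPhysics.KineticTheory.T3 → ℝ, (∀ N, MeasureTheory.IsProbabilityMeasure (Literature.MathematicalPhysics.KineticTheory.localGibbsLaw σ a (u t) (θ t) N (Φ N))) ∧ (∀ χ : Literature.MathematicalPhysics.KineticTheory.T3 → ℝ, Continuous χ → ∀ δ : ℝ, 0 < δ → ∃ C : ℝ, 0 < C ∧ ∀ N : ℕ, Literature.MathematicalPhysics.KineticTheory.localGibbsLaw σ a (u t) (θ t) N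 (Φ N) {z | δ < |Literature.MathematicalPhysics.KineticTheory.empiricalDensityField z χ - ∫ x, χ x * ρ t x|} ≤ ENNReal.ofReal (C * Real.exp (-(C⁻¹ * (N + 1)))) ∧ Literature.MathematicalPhysics.KineticTheory.localGibbsLaw σ a (u t) (θ t) N (Φ N) {z | δ < ‖Literature.MathematicalPhysics.KineticTheory.empiricalMomentumField z χ - ∫ x, (χ x * ρ t x) • u t x‖} ≤ ENNReal.ofReal (C * Real.exp (-(C⁻¹ * (N + 1)))) ∧ Literature.MathematicalPhysics.KineticTheory.localGibbsLaw σ a (u t) (θ t) N (Φ N) {z | δ < |Literature.MathematicalPhysics.KineticTheory.empiricalEnergyField z χ - ∫ x, χ x * Literature.MathematicalPhysics.KineticTheory.totalEnergyDensity (ρ t x) (u t x) (θ t x)|} ≤ ENNReal.ofReal (C * Real.exp (-(C⁻¹ * (N + 1))))) ∧ ∃ C : ℝ, ∀ N : ℕ, InformationTheory.klDiv ((Φ N).lawAt (Literature.MathematicalPhysics.KineticTheory.localGibbsLaw σ a₀ u₀ θ₀ N (Φ N)) t) (Literature.MathematicalPhysics.KineticTheory.localGibbsLaw σ a (u t) (θ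 t) N (Φ N)) ≤ ENNReal.ofReal (C * ((N : ℝ) + 1) ^ (2 / 3 : ℝ)))

/-- item stmt-AtomisticToContinuum-12340 · crux · rank 2 · open · by planner
why it might fail: Needs an N-uniform relaxation RATE for the linearised hard-sphere collision dynamics at fixed density plus recollision control — the Boltzmann-hypothesis step with a rate, unproved for any deterministic interacting system; the cubic energy flux needs LargeVelocityControl-type input.
sources: Yau1991, OllaVaradhanYau1993, Spohn1991, Grad1963, ChapmanCowling1970, VanbeijerenErnst1973
[crux] LOCAL EQUILIBRIUM OF THE FAST MOMENTS AT KNUDSEN PRECISION (kinetic half of the quantitative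
one-block estimate): under the hypotheses of X, for t < T, every smooth test function χ and
components j,k, the time-integrated expected empirical kinetic stress (N+1)⁻¹Σ χ(x_i) v_i,j v_i,k
and kinetic energy flux (N+1)⁻¹Σ χ(x_i) v_i,j|v_i|²/2 along the deterministic evolution differ from
their local-Maxwellian values at the Euler state, ∫χρ_s(u_s,j u_s,k + θ_s δ_jk) and ∫χ(E_s +
ρ_sθ_s)u_s,j, by at most C (N+1)^(-1/3) (the size of the viscous stress / heat flux). Engine cards
chapman-enskog-corrector / kinetic-windows-inside-yau would deliver it; the collisional-transfer
half needs a contact-current definition (Not decomposed yet). [difficulty: open-problem] -/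
@[route_item "route-AtomisticToContinuum-KnudsenRateHorizon"]
def KineticFluxRelaxation : Prop :=
  ∀ (a₀ θ₀ : Literature.MathematicalPhysics.KineticTheory.T3 → ℝ) (u₀ : Literature.MathematicalPhysics.KineticTheory.T3 → Literature.MathematicalPhysics.KineticTheory.V3), Continuous a₀ → Continuous θ₀ → Continuous u₀ → (∀ x, 0 < a₀ x) → (∀ x, 0 < θ₀ x) → ∃ σ₀ : ℝ, 0 < σ₀ ∧ ∀ σ : ℝ, 0 < σ → σ < σ₀ → ∀ (T : ℝ) (ρ θ : ℝ → Literature.MathematicalPhysics.KineticTheory.T3 → ℝ) (u : ℝ → Literature.MathematicalPhysics.KineticTheory.T3 → Literature.MathematicalPhysics.KineticTheory.V3), Literature.MathematicalPhysics.KineticTheory.IsHardSphereEulerSolution σ T ρ u θ → ∀ Φ : (N : ℕ) → Literature.Analysis.FluidPDE.HardSphereFlow (Literature.Analysis.FluidPDE.Torus.geometry (Fin 3)) (Literature.MathematicalPhysics.KineticTheory.hsDiameter σ N) (N + 1), (∀ N, MeasureTheory.IsProbabilityMeasure (Literature.MathematicalPhysics.KineticTheory.localGibbsLaw σ a₀ u₀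 θ₀ N (Φ N))) ∧ (Literature.MathematicalPhysics.KineticTheory.TendstoHydroFieldsAt (fun N => Literature.MathematicalPhysics.KineticTheory.localGibbsLaw σ a₀ u₀ θ₀ N (Φ N)) Φ ρ u θ 0 → ∀ t ∈ Set.Ico 0 T, ∀ χ : Literature.MathematicalPhysics.KineticTheory.T3 → ℝ, Literature.Analysis.FunctionSpaces.Torus.IsSmooth χ → ∀ j k : Fin 3, ∃ C : ℝ, ∀ N : ℕ, |∫ s in (0 : ℝ)..t, ((∫ z, (∫ y, χ y.1 * (y.2 j * y.2 k) ∂(Literature.Analysis.FluidPDE.empiricalMeasure ((Φ N).flow s z))) ∂(Literature.MathematicalPhysics.KineticTheory.localGibbsLaw σ a₀ u₀ θ₀ N (Φ N))) - ∫ x, χ x * (ρ s x * (u s x j * u s x k + if j = k then θ s x else 0)))| ≤ C * ((N : ℝ) + 1) ^ (-(1 / 3 : ℝ)) ∧ |∫ s in (0 : ℝ)..t, ((∫ z, (∫ y, χ y.1 * (‖y.2‖ ^ 2 / 2 * y.2 j) ∂(Literature.Analysis.FluidPDE.empiricalMeasure ((Φ N).flow s z))) ∂(Literature.MathematicalPhysics.KineticTheory.localGibbsLaw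 σ a₀ u₀ θ₀ N (Φ N))) - ∫ x, χ x * ((Literature.MathematicalPhysics.KineticTheory.totalEnergyDensity (ρ s x) (u s x) (θ s x) + ρ s x * θ s x) * u s x j))| ≤ C * ((N : ℝ) + 1) ^ (-(1 / 3 : ℝ)))

/-- item stmt-AtomisticToContinuum-12341 · crux · rank 3 · open · by planner
why it might fail: If hydrodynamics holds in the mean only with o(1) but not O(Kn) error (anomalous relaxation, cf. the N^(-1/6) Lagrangian-coherence rate) this fails while 0766 survives; for large T compressive smooth solutions can leave the dilute EOS regime at fixed σ (implosion loophole).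
sources: OllaVaradhanYau1993, KipnisLandim1999, Spohn1991, arXiv:2412.16714, Yau1991
[crux] HYDRODYNAMICS IN THE MEAN TO NAVIER–STOKES PRECISION (card (Q1) in its MD-measurable form):
under the hypotheses of X, for t < T there is a positive reference activity a (probability +
exponential concentration clauses as in X) and C with Θ_N(t) ≤ C (N+1)^(-1/3) for all N, where
Θ_N(t) = E_λ⟨emp, g_t⟩ − E⟨emp(Φ_N,t z), g_t⟩, g_t = log localGibbsProfile a u_t θ_t = (log a −
3/2·log 2πθ_t − |u_t|²/2θ_t) + v·u_t/θ_t − |v|²/2θ_t: five expected empirical fields paired with the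
Euler conjugate variables; one-sided suffices (Θ_N ≥ −O(N^(-2/3)) from H ≥ 0). With
EntropySaturationKnudsen this is equivalent to X (foreseen glue). [deps: KineticFluxRelaxation]
[difficulty: open-problem] -/
@[route_item "route-AtomisticToContinuum-KnudsenRateHorizon"]
def MeanFieldKnudsenAccuracy : Prop :=
  ∀ (a₀ θ₀ : Literature.MathematicalPhysics.KineticTheory.T3 → ℝ) (u₀ : Literature.MathematicalPhysics.KineticTheory.T3 → Literature.MathematicalPhysics.KineticTheory.V3), Continuous a₀ → Continuous θ₀ → Continuous u₀ → (∀ x, 0 < a₀ x) → (∀ x, 0 < θ₀ x) → ∃ σ₀ : ℝ, 0 < σ₀ ∧ ∀ σ : ℝ, 0 < σ → σ < σ₀ → ∀ (T : ℝ) (ρ θ : ℝ → Literature.MathematicalPhysics.KineticTheory.T3 → ℝ) (u : ℝ → Literature.MathematicalPhysics.KineticTheory.T3 → Literature.MathematicalPhysics.KineticTheory.V3), Literature.MathematicalPhysics.KineticTheory.IsHardSphereEulerSolution σ T ρ u θ → ∀ Φ : (N : ℕ) → Literature.Analysis.FluidPDE.HardSphereFlow (Literature.Analysis.FluidPDE.Torus.geometry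 (Fin 3)) (Literature.MathematicalPhysics.KineticTheory.hsDiameter σ N) (N + 1), (∀ N, MeasureTheory.IsProbabilityMeasure (Literature.MathematicalPhysics.KineticTheory.localGibbsLaw σ a₀ u₀ θ₀ N (Φ N))) ∧ (Literature.MathematicalPhysics.KineticTheory.TendstoHydroFieldsAt (fun N => Literature.MathematicalPhysics.KineticTheory.localGibbsLaw σ a₀ u₀ θ₀ N (Φ N)) Φ ρ u θ 0 → ∀ t ∈ Set.Ico 0 T, ∃ a : Literature.MathematicalPhysics.KineticTheory.T3 → ℝ, (∀ x, 0 < a x) ∧ (∀ N, MeasureTheory.IsProbabilityMeasure (Literature.MathematicalPhysics.KineticTheory.localGibbsLaw σ a (u t) (θ t) N (Φ N))) ∧ (∀ χ : Literature.MathematicalPhysics.KineticTheory.T3 → ℝ, Continuous χ → ∀ δ : ℝ, 0 < δ → ∃ C : ℝ, 0 < C ∧ ∀ N : ℕ, Literature.MathematicalPhysics.KineticTheory.localGibbsLaw σ a (u t) (θ t) N (Φ N) {z | δ < |Literature.MathematicalPhysics.KineticTheory.empiricalDensityField z χ - ∫ x, χ x * ρ t x|} ≤ ENNReal.ofReal (C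 * Real.exp (-(C⁻¹ * (N + 1)))) ∧ Literature.MathematicalPhysics.KineticTheory.localGibbsLaw σ a (u t) (θ t) N (Φ N) {z | δ < ‖Literature.MathematicalPhysics.KineticTheory.empiricalMomentumField z χ - ∫ x, (χ x * ρ t x) • u t x‖} ≤ ENNReal.ofReal (C * Real.exp (-(C⁻¹ * (N + 1)))) ∧ Literature.MathematicalPhysics.KineticTheory.localGibbsLaw σ a (u t) (θ t) N (Φ N) {z | δ < |Literature.MathematicalPhysics.KineticTheory.empiricalEnergyField z χ - ∫ x, χ x * Literature.MathematicalPhysics.KineticTheory.totalEnergyDensity (ρ t x) (u t x) (θ t x)|} ≤ ENNReal.ofReal (C * Real.exp (-(C⁻¹ * (N + 1))))) ∧ ∃ C : ℝ, ∀ N : ℕ, ((∫ z, (∫ y, Real.log (Literature.MathematicalPhysics.KineticTheory.localGibbsProfile a (u t) (θ t) y) ∂(Literature.Analysis.FluidPDE.empiricalMeasure z)) ∂(Literature.MathematicalPhysics.KineticTheory.localGibbsLaw σ a (u t) (θ t) N (Φ N))) - (∫ z, (∫ y, Real.log (Literature.MathematicalPhysics.KineticTheory.localGibbsProfile a (u t)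 (θ t) y) ∂(Literature.Analysis.FluidPDE.empiricalMeasure ((Φ N).flow t z))) ∂(Literature.MathematicalPhysics.KineticTheory.localGibbsLaw σ a₀ u₀ θ₀ N (Φ N)))) ≤ C * ((N : ℝ) + 1) ^ (-(1 / 3 : ℝ)))

/-- item stmt-AtomisticToContinuum-12342 · crux · rank 4 · open · by planner
why it might fail: Requires compressible Navier–Stokes corrections IN THE MEAN for deterministic hard spheres (open even with noise: only incompressible NS is derived for stochastic lattice gases, Esposito–Marra–Yau); at fixed σ mode-coupling terms O(Kn^(3/2)) sit close to the O(Kn) signal.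
sources: Spohn1991, doi:10.1007/bf02517896, doi:10.1002/cpa.3160420810, KipnisLandim1999, Dorfman1999, EvansMorriss2008
[crux] THE SECOND-ORDER LAW (card law (1)/(Q2)): there are continuous coefficient functions η, ζ, κ
of (σ; ρ, θ), η, κ > 0, ζ ≥ 0 (hard-sphere shear/bulk viscosity and heat conductivity in Knudsen
units — existence claimed, no density expansion, no Enskog values), universal over profiles,
solutions and flows, such that under the hypotheses of X, for t < T: (N+1)^(1/3)·Θ_N(t) → ∫₀ᵗ∫_𝕋³
[η|S(u)|²/(2θ) + ζ(div u)²/θ + κ|∇θ|²/θ²](s,x) dx ds, S(u) = ∇u + ∇uᵀ − (2/3)(div u)𝟙, evaluated on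
the EULER solution: Yau's entropy per particle, magnified by Kn⁻¹, converges to the Navier–Stokes
entropy production the Euler flow would have. Implies MeanFieldKnudsenAccuracy with the sharp
constant and a matching lower bound; it is the statement event-driven MD tests. [deps:
MeanFieldKnudsenAccuracy] [difficulty: open-problem] -/
@[route_item "route-AtomisticToContinuum-KnudsenRateHorizon"]
def KnudsenRateLaw : Prop :=
  ∃ η ζ κ : ℝ → ℝ → ℝ → ℝ, (∀ σ : ℝ, 0 < σ → Continuous (fun p : ℝ × ℝ => (η σ p.1 p.2, ζ σ p.1 p.2, κ σ p.1 p.2))) ∧ (∀ σ r ϑ : ℝ, 0 < σ → 0 < r → 0 < ϑ → 0 < η σ r ϑ ∧ 0 ≤ ζ σ r ϑ ∧ 0 < κ σ r ϑ) ∧ ∀ (a₀ θ₀ : Literature.MathematicalPhysics.KineticTheory.T3 → ℝ) (u₀ : Literature.MathematicalPhysics.KineticTheory.T3 → Literature.MathematicalPhysics.KineticTheory.V3), Continuous a₀ → Continuous θ₀ → Continuous u₀ → (∀ x, 0 < a₀ x) → (∀ x, 0 < θ₀ x) → ∃ σ₀ : ℝ, 0 < σ₀ ∧ ∀ σ : ℝ,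 0 < σ → σ < σ₀ → ∀ (T : ℝ) (ρ θ : ℝ → Literature.MathematicalPhysics.KineticTheory.T3 → ℝ) (u : ℝ → Literature.MathematicalPhysics.KineticTheory.T3 → Literature.MathematicalPhysics.KineticTheory.V3), Literature.MathematicalPhysics.KineticTheory.IsHardSphereEulerSolution σ T ρ u θ → ∀ Φ : (N : ℕ) → Literature.Analysis.FluidPDE.HardSphereFlow (Literature.Analysis.FluidPDE.Torus.geometry (Fin 3)) (Literature.MathematicalPhysics.KineticTheory.hsDiameter σ N) (N + 1), (∀ N, MeasureTheory.IsProbabilityMeasure (Literature.MathematicalPhysics.KineticTheory.localGibbsLaw σ a₀ u₀ θ₀ N (Φ N))) ∧ (Literature.MathematicalPhysics.KineticTheory.TendstoHydroFieldsAt (fun N => Literature.MathematicalPhysics.KineticTheory.localGibbsLaw σ a₀ u₀ θ₀ N (Φ N)) Φ ρ u θ 0 → ∀ t ∈ Set.Ico 0 T, ∃ a : Literature.MathematicalPhysics.KineticTheory.T3 → ℝ, (∀ x, 0 < a x) ∧ (∀ N, MeasureTheory.IsProbabilityMeasure (Literature.MathematicalPhysics.KineticTheory.localGibbsLaw σ a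 (u t) (θ t) N (Φ N))) ∧ (∀ χ : Literature.MathematicalPhysics.KineticTheory.T3 → ℝ, Continuous χ → ∀ δ : ℝ, 0 < δ → ∃ C : ℝ, 0 < C ∧ ∀ N : ℕ, Literature.MathematicalPhysics.KineticTheory.localGibbsLaw σ a (u t) (θ t) N (Φ N) {z | δ < |Literature.MathematicalPhysics.KineticTheory.empiricalDensityField z χ - ∫ x, χ x * ρ t x|} ≤ ENNReal.ofReal (C * Real.exp (-(C⁻¹ * (N + 1)))) ∧ Literature.MathematicalPhysics.KineticTheory.localGibbsLaw σ a (u t) (θ t) N (Φ N) {z | δ < ‖Literature.MathematicalPhysics.KineticTheory.empiricalMomentumField z χ - ∫ x, (χ x * ρ t x) • u t x‖} ≤ ENNReal.ofReal (C * Real.exp (-(C⁻¹ * (N + 1)))) ∧ Literature.MathematicalPhysics.KineticTheory.localGibbsLaw σ a (u t) (θ t) N (Φ N) {z | δ < |Literature.MathematicalPhysics.KineticTheory.empiricalEnergyField z χ - ∫ x, χ x * Literature.MathematicalPhysics.KineticTheory.totalEnergyDensity (ρ t x) (u t x) (θ t x)|} ≤ ENNReal.ofReal (C * Real.exp (-(C⁻¹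 * (N + 1))))) ∧ Filter.Tendsto (fun N : ℕ => ((N : ℝ) + 1) ^ (1 / 3 : ℝ) * ((∫ z, (∫ y, Real.log (Literature.MathematicalPhysics.KineticTheory.localGibbsProfile a (u t) (θ t) y) ∂(Literature.Analysis.FluidPDE.empiricalMeasure z)) ∂(Literature.MathematicalPhysics.KineticTheory.localGibbsLaw σ a (u t) (θ t) N (Φ N))) - (∫ z, (∫ y, Real.log (Literature.MathematicalPhysics.KineticTheory.localGibbsProfile a (u t) (θ t) y) ∂(Literature.Analysis.FluidPDE.empiricalMeasure ((Φ N).flow t z))) ∂(Literature.MathematicalPhysics.KineticTheory.localGibbsLaw σ a₀ u₀ θ₀ N (Φ N))))) Filter.atTop (nhds (∫ s in (0 : ℝ)..t, ∫ x, (η σ (ρ s x) (θ s x) / (2 * θ s x) * (∑ i : Fin 3, ∑ j : Fin 3, (Literature.Analysis.FunctionSpaces.Torus.partialDeriv i (fun y => u s y j) x + Literature.Analysis.FunctionSpaces.Torus.partialDeriv j (fun y => u s y i) x - (if i = j then (2 / 3 : ℝ) * Literature.Analysis.FunctionSpaces.Torus.divergence (u s) x else 0)) ^ 2) + ζ σ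 (ρ s x) (θ s x) / θ s x * (Literature.Analysis.FunctionSpaces.Torus.divergence (u s) x) ^ 2 + κ σ (ρ s x) (θ s x) / (θ s x) ^ 2 * ‖Literature.Analysis.FunctionSpaces.Torus.gradient (θ s) x‖ ^ 2))))

/-- item stmt-AtomisticToContinuum-17396 · crux · rank 9 · open · by planner
why it might fail: The conjunct in Yau's entropy form inside the dilute band (weaker than X): entropy production ≥ cN before the first shock for some smooth dilute data (a focusing mode invisible to the energy) refutes it and every entropy route; known only with noise (OVY93 Thm 2.1).
sources: Yau1991, OllaVaradhanYau1993, KipnisLandim1999, Spohn1991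
[target] PACKING-GUARDED X_RE — the shared Yau-form target stmt-AtomisticToContinuum-0766 made to
match the RE-TYPED conjunct (Statement retype p126922, 2026-08-16: `_root_.HydrodynamicLimit` is now
the packing-guarded limit, ∃ η₀ outermost, guard ∀ t ∈ [0,T) ∀ x, ρ_t(x)σ³ < η₀ after the solution
hypothesis): there is η₀ > 0 (prover-chosen) such that for all continuous positive profiles ∃ σ₀ ∀
0<σ<σ₀ ∀ T ∀ classical hs-Euler solutions (ρ,u,θ) on [0,T) WHOSE LOCAL PACKING STAYS BELOW η₀ ∀ flow
families Φ: the initial local Gibbs laws are probability measures and, if their empirical fields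
converge at t = 0, then ∀ t < T ∃ activity profile a_t such that the reference local Gibbs law (a_t,
u_t, θ_t) is a probability measure whose density/momentum/energy fields concentrate exponentially (≤
C e^{-(N+1)/C}) around (ρ, ρu, E)(t) and klDiv(lawAt Φ_N (localGibbs a₀ u₀ θ₀) t ‖ localGibbs a_t
u_t θ_t)/(N+1) → 0. CANONICAL FORM: 0766 verbatim with the Statement's guard clause inserted at the
Statement's position and `∃ η₀ : ℝ, 0 < η₀ ∧` prefixed — sibling Yau-family routes re-targeting
after the retype should attach to THIS signature (dedup). 0766 ⇒ this (take η₀ := 1 and ignore the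
guard; Ske -/
@[route_item "route-AtomisticToContinuum-KnudsenRateHorizon"]
def RelEntropyVanishingInBand : Prop :=
  ∃ η₀ : ℝ, 0 < η₀ ∧ ∀ (a₀ θ₀ : Literature.MathematicalPhysics.KineticTheory.T3 → ℝ) (u₀ : Literature.MathematicalPhysics.KineticTheory.T3 → Literature.MathematicalPhysics.KineticTheory.V3), Continuous a₀ → Continuous θ₀ → Continuous u₀ → (∀ x, 0 < a₀ x) → (∀ x, 0 < θ₀ x) → ∃ σ₀ : ℝ, 0 < σ₀ ∧ ∀ σ : ℝ, 0 < σ → σ < σ₀ → ∀ (T : ℝ) (ρ θ : ℝ → Literature.MathematicalPhysics.KineticTheory.T3 → ℝ) (u : ℝ → Literature.MathematicalPhysics.KineticTheory.T3 → Literature.MathematicalPhysics.KineticTheory.V3), Literature.MathematicalPhysics.KineticTheory.IsHardSphereEulerSolution σ T ρ u θ → (∀ t ∈ Set.Ico 0 T, ∀ x, ρ t x * σ ^ 3 < η₀) → ∀ Φ : (N : ℕ) → Literature.Analysis.FluidPDE.HardSphereFlow (Literature.Analysis.FluidPDE.Torus.geometry (Fin 3)) (Literature.MathematicalPhysics.KineticTheory.hsDiameter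 σ N) (N + 1), (∀ N, MeasureTheory.IsProbabilityMeasure (Literature.MathematicalPhysics.KineticTheory.localGibbsLaw σ a₀ u₀ θ₀ N (Φ N))) ∧ (Literature.MathematicalPhysics.KineticTheory.TendstoHydroFieldsAt (fun N => Literature.MathematicalPhysics.KineticTheory.localGibbsLaw σ a₀ u₀ θ₀ N (Φ N)) Φ ρ u θ 0 → ∀ t ∈ Set.Ico 0 T, ∃ a : Literature.MathematicalPhysics.KineticTheory.T3 → ℝ, (∀ N, MeasureTheory.IsProbabilityMeasure (Literature.MathematicalPhysics.KineticTheory.localGibbsLaw σ a (u t) (θ t) N (Φ N))) ∧ (∀ χ : Literature.MathematicalPhysics.KineticTheory.T3 → ℝ, Continuous χ → ∀ δ : ℝ, 0 < δ → ∃ C : ℝ, 0 < C ∧ ∀ N : ℕ, Literature.MathematicalPhysics.KineticTheory.localGibbsLaw σ a (u t) (θ t) N (Φ N) {z | δ < |Literature.MathematicalPhysics.KineticTheory.empiricalDensityField z χ - ∫ x, χ x * ρ t x|} ≤ ENNReal.ofReal (C * Real.exp (-(C⁻¹ * (N + 1)))) ∧ Literature.MathematicalPhysics.KineticTheory.localGibbsLaw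 σ a (u t) (θ t) N (Φ N) {z | δ < ‖Literature.MathematicalPhysics.KineticTheory.empiricalMomentumField z χ - ∫ x, (χ x * ρ t x) • u t x‖} ≤ ENNReal.ofReal (C * Real.exp (-(C⁻¹ * (N + 1)))) ∧ Literature.MathematicalPhysics.KineticTheory.localGibbsLaw σ a (u t) (θ t) N (Φ N) {z | δ < |Literature.MathematicalPhysics.KineticTheory.empiricalEnergyField z χ - ∫ x, χ x * Literature.MathematicalPhysics.KineticTheory.totalEnergyDensity (ρ t x) (u t x) (θ t x)|} ≤ ENNReal.ofReal (C * Real.exp (-(C⁻¹ * (N + 1))))) ∧ Filter.Tendsto (fun N : ℕ => InformationTheory.klDiv ((Φ N).lawAt (Literature.MathematicalPhysics.KineticTheory.localGibbsLaw σ a₀ u₀ θ₀ N (Φ N)) t) (Literature.MathematicalPhysics.KineticTheory.localGibbsLaw σ a (u t) (θ t) N (Φ N)) / ((N : ENNReal) + 1)) Filter.atTop (nhds 0))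

/-- item stmt-AtomisticToContinuum-17397 · crux · rank 9 · open · by planner
why it might fail: No research risk: it is the landed dock Theorems.hydroLimitInBand_of_relEntropyVanishingInBand up to the registered iff's (tendstoHydroFieldsAt_of_klDiv at each t); crux only by the glue.non-crux-hypothesis rule until a Theorems file states it for this decl.
sources: KipnisLandim1999, OllaVaradhanYau1993, Yau1991
[support] GUARDED ENTROPY DOCK (packing-guarded twin of the closed glue item
stmt-AtomisticToContinuum-0769 EntropyToFields): RelEntropyVanishingInBand → the re-typed conjunct
`_root_.HydrodynamicLimit`. Proof (8 lines, checked rc 0 in the planner's Sketch.lean, attached as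
evidence): take η₀ and σ₀ from the hypothesis; for σ < σ₀, a guarded classical solution, Φ,
convergence at t = 0 and t < T, obtain ⟨a_t, probability, concentration, klDiv → 0⟩ and apply the
tree lemma Summit.AtomisticToContinuum.HydrodynamicLimit.Theorems.tendstoHydroFieldsAt_of_klDiv
(Theorems/TwoClocksEntropyToHydro.lean: entropy inequality for events μ(A)·L ≤ KL(μ‖ν) + (e^L −
1)ν(A), exponential concentration of the reference, transfer along the measurable flow). Becomes the
last hypothesis of `closes` (replacing EntropyToFields + HydrodynamicLimit.of_unguarded) once crux
#4 is restated to conclude RelEntropyVanishingInBand. [deps: RelEntropyVanishingInBand] [difficulty: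
S] -/
@[route_item "route-AtomisticToContinuum-KnudsenRateHorizon", crux]
def EntropyToFieldsInBand : Prop :=
  RelEntropyVanishingInBand → _root_.HydrodynamicLimit

/-- item stmt-AtomisticToContinuum-12343 · support · rank 5 · open · by planner
why it might fail: Rests on linearised fluctuating hydrodynamics up to times ~log N (unproved even at equilibrium); finite Mach number and the hard-sphere EOS weaken the inviscid Kolmogorov instability; nonlinear saturation might keep the k=1 amplitude below any fixed δ with probability → 1.
sources: MeshalkinSinai1961, doi:10.1137/s0036139997327575, Spohn1991, doi:10.1073/pnas.0401228101, doi:10.1103/physreve.105.065113, doi:10.1103/physrevlett.132.104002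
[crux] NEGATIVE SIDE — THE log N HORIZON (card (2)/(Q3); candidate entry for
Literature/Barriers/AtomisticToContinuum): there are A, θ₀, σ₀ > 0 such that for 0 < σ < σ₀ and
every family of flows, for the Kolmogorov local Gibbs data (a ≡ 1, u₀ = A sin(4πx₁)e₀, θ ≡ θ₀; an
exact steady smooth Euler solution for all times, support KolmogorovSteady) there are a continuous χ
and δ, c, C > 0 with, for infinitely many N, P_N(‖momentum field(Φ_N,t_N z)(χ) − ∫χu₀‖ > δ) ≥ c at
t_N = C log(N+2): convergence of the empirical fields FAILS along a logarithmic time sequence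
although T = ∞. Heuristic: the inviscidly unstable k = 1 mode (Rayleigh; Meshalkin–Sinai;
Belenkaya–Friedlander–Yudovich) starts at thermal amplitude N^(-1/2), is transported by linearised
Euler (Spohn (7.28)), reaches O(1) with random phase at (2γ)⁻¹ log N; collisional damping ~Kn k² is
irrelevant for fixed k. Outside the conjunct (fixed t), so consistent with X; it bounds every
growing-time strengthening and explains the e^(Ct) of relative-entropy Gronwall as sharp. Not a
hypothesis of `closes`. [deps: KolmogorovSteady] [difficulty: open-problem] -/
@[route_item "route-AtomisticToContinuum-KnudsenRateHorizon"]
def EhrenfestHorizon : Prop :=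
  ∃ A θ₀ σ₀ : ℝ, 0 < A ∧ 0 < θ₀ ∧ 0 < σ₀ ∧ ∀ σ : ℝ, 0 < σ → σ < σ₀ → ∀ Φ : (N : ℕ) → Literature.Analysis.FluidPDE.HardSphereFlow (Literature.Analysis.FluidPDE.Torus.geometry (Fin 3)) (Literature.MathematicalPhysics.KineticTheory.hsDiameter σ N) (N + 1), ∃ χ : Literature.MathematicalPhysics.KineticTheory.T3 → ℝ, Continuous χ ∧ ∃ δ c C : ℝ, 0 < δ ∧ 0 < c ∧ 0 < C ∧ ∃ᶠ N : ℕ in Filter.atTop, ENNReal.ofReal c ≤ (Literature.MathematicalPhysics.KineticTheory.localGibbsLaw σ (fun _ => 1) (fun x : Literature.MathematicalPhysics.KineticTheory.T3 => (A * Real.sin (4 * Real.pi * (Literature.Analysis.FunctionSpaces.Torus.repr x) 1)) • EuclideanSpace.single (0 : Fin 3) (1 : ℝ)) (fun _ => θ₀) N (Φ N)) {z | δ < ‖Literature.MathematicalPhysics.KineticTheory.empiricalMomentumField ((Φ N).flow (C * Real.log ((N : ℝ) + 2)) z) χ - ∫ x, χ x • (fun x : Literature.MathematicalPhysics.KineticTheory.T3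 => (A * Real.sin (4 * Real.pi * (Literature.Analysis.FunctionSpaces.Torus.repr x) 1)) • EuclideanSpace.single (0 : Fin 3) (1 : ℝ)) x‖}

/-- item stmt-AtomisticToContinuum-12345 · support · rank 9 · open · by planner
sources: MeshalkinSinai1961, Spohn1991
[support] the Kolmogorov shear data of EhrenfestHorizon is an exact steady classical hard-sphere
Euler solution for every σ, T and θ₀ > 0: ρ ≡ 1, u(x) = A sin(4π x₁) e₀, θ ≡ θ₀ (div u = 0, (u·∇)u =
0, p constant; smoothness of x ↦ sin(4π·repr(x)₁) on the torus, period 1/2). Grounds that the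
horizon data lie inside the conjunct's hypothesis class with T = ∞. [difficulty: provable-now] -/
@[route_item "route-AtomisticToContinuum-KnudsenRateHorizon"]
def KolmogorovSteady : Prop :=
  ∀ A θ₀ σ T : ℝ, 0 < θ₀ → Literature.MathematicalPhysics.KineticTheory.IsHardSphereEulerSolution σ T (fun _ _ => 1) (fun _ => (fun x : Literature.MathematicalPhysics.KineticTheory.T3 => (A * Real.sin (4 * Real.pi * (Literature.Analysis.FunctionSpaces.Torus.repr x) 1)) • EuclideanSpace.single (0 : Fin 3) (1 : ℝ))) (fun _ _ => θ₀)

-- earlier EntropySaturationKnudsen (stmt-AtomisticToContinuum-12344, replaced 2026-08-16T03:15:25Z -> stmt-AtomisticToContinuum-14322): retired by None — ∀ (a₀ θ₀ : Literature.MathematicalPhysics.KineticTheory.T3 → ℝ) (u₀ : Literature.MathematicalPhysics.KineticTheory.T3 → Literature.MathematicalPhysics.KineticTheory.V3), Continuous a₀ → Continuous θ₀ → Continuous u₀ → (∀ x, 0 < a₀ x) → (∀ x, 0 < θ₀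
/-- item stmt-AtomisticToContinuum-14322 · support · rank 9 · open · by planner
sources: Yau1991, Ruelle1969, LebowitzPenrose1964, SaintRaymond2009, Spohn1991
[support] QUANTITATIVE ENTROPY-SATURATION IDENTITY — band-guarded ENNReal form (restated 2026-08-16,
badge repair; the statistical-mechanics half of the glue MeanFieldKnudsenAccuracy → X): there is a
packing threshold ηs > 0 (chosen by the prover inside the cluster-expansion / HsEosLowDensity
radius) such that under the hypotheses of X, for t < T, IF the Euler solution stays in the band
ρ_s(x)σ³ < ηs on [0,t], THEN for EVERY positive reference activity a whose local Gibbs law λ^a_t =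
localGibbsLaw σ a u_t θ_t is a probability measure with fields concentrating exponentially around
(ρ,ρu,E)(t): ∃ C ∀ N, klDiv(lawAt Φ_N P_N t ‖ λ^a_t) ≤ ofReal((N+1)(Θ^a_N(t) + C(N+1)^(-1/3))) and
ofReal((N+1)(Θ^a_N(t) − C(N+1)^(-1/3))) ≤ klDiv, i.e. H_N(t) is FINITE and |H_N(t)/(N+1) − Θ^a_N(t)|
≤ C(N+1)^(-1/3), where Θ^a_N(t) = E_λ⟨emp, log g^a_t⟩ − E_P⟨emp∘flow_t, log g^a_t⟩, g^a_t =
localGibbsProfile a u_t θ_t. Replaces the rev-0 form (hypothesis 'f_ex ∈ C² on the visited range',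
which no item could discharge under ∀T; conclusion via klDiv.toReal, = 0 when klDiv = ⊤), which made
the glue to X non-logical (cone-repair note 2026-08-15). Sketch: H = S(λ^a_t) − S(P_N) +
(N+1)Θ^a_N(t) EXACTLY (log λ^a_t -/
@[route_item "route-AtomisticToContinuum-KnudsenRateHorizon"]
def EntropySaturationKnudsen : Prop :=
  ∃ ηs : ℝ, 0 < ηs ∧ ∀ (a₀ θ₀ : Literature.MathematicalPhysics.KineticTheory.T3 → ℝ) (u₀ : Literature.MathematicalPhysics.KineticTheory.T3 → Literature.MathematicalPhysics.KineticTheory.V3), Continuous a₀ → Continuous θ₀ → Continuous u₀ → (∀ x, 0 < a₀ x) → (∀ x, 0 < θ₀ x) → ∃ σ₀ : ℝ, 0 < σ₀ ∧ ∀ σ : ℝ, 0 < σ → σ < σ₀ → ∀ (T : ℝ) (ρ θ : ℝ → Literature.MathematicalPhysics.KineticTheory.T3 → ℝ) (u : ℝ → Literature.MathematicalPhysics.KineticTheory.T3 → Literature.MathematicalPhysics.KineticTheory.V3), Literature.MathematicalPhysics.KineticTheory.IsHardSphereEulerSolution σ T ρ u θ → ∀ Φ : (N : ℕ) → Literature.Analysis.FluidPDE.HardSphereFlow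 (Literature.Analysis.FluidPDE.Torus.geometry (Fin 3)) (Literature.MathematicalPhysics.KineticTheory.hsDiameter σ N) (N + 1), Literature.MathematicalPhysics.KineticTheory.TendstoHydroFieldsAt (fun N => Literature.MathematicalPhysics.KineticTheory.localGibbsLaw σ a₀ u₀ θ₀ N (Φ N)) Φ ρ u θ 0 → ∀ t ∈ Set.Ico 0 T, (∀ s ∈ Set.Icc 0 t, ∀ x, ρ s x * σ ^ 3 < ηs) → ∀ a : Literature.MathematicalPhysics.KineticTheory.T3 → ℝ, (∀ x, 0 < a x) → (∀ N, MeasureTheory.IsProbabilityMeasure (Literature.MathematicalPhysics.KineticTheory.localGibbsLaw σ a (u t) (θ t) N (Φ N))) → (∀ χ : Literature.MathematicalPhysics.KineticTheory.T3 → ℝ, Continuous χ → ∀ δ : ℝ, 0 < δ → ∃ C : ℝ, 0 < C ∧ ∀ N : ℕ, Literature.MathematicalPhysics.KineticTheory.localGibbsLaw σ a (u t) (θ t) N (Φ N) {z | δ < |Literature.MathematicalPhysics.KineticTheory.empiricalDensityField z χ - ∫ x, χ x * ρ t x|} ≤ ENNReal.ofReal (C * Real.exp (-(C⁻¹ * (N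 + 1)))) ∧ Literature.MathematicalPhysics.KineticTheory.localGibbsLaw σ a (u t) (θ t) N (Φ N) {z | δ < ‖Literature.MathematicalPhysics.KineticTheory.empiricalMomentumField z χ - ∫ x, (χ x * ρ t x) • u t x‖} ≤ ENNReal.ofReal (C * Real.exp (-(C⁻¹ * (N + 1)))) ∧ Literature.MathematicalPhysics.KineticTheory.localGibbsLaw σ a (u t) (θ t) N (Φ N) {z | δ < |Literature.MathematicalPhysics.KineticTheory.empiricalEnergyField z χ - ∫ x, χ x * Literature.MathematicalPhysics.KineticTheory.totalEnergyDensity (ρ t x) (u t x) (θ t x)|} ≤ ENNReal.ofReal (C * Real.exp (-(C⁻¹ * (N + 1))))) → ∃ C : ℝ, ∀ N : ℕ, InformationTheory.klDiv ((Φ N).lawAt (Literature.MathematicalPhysics.KineticTheory.localGibbsLaw σ a₀ u₀ θ₀ N (Φ N)) t) (Literature.MathematicalPhysics.KineticTheory.localGibbsLaw σ a (u t) (θ t) N (Φ N)) ≤ ENNReal.ofReal (((N : ℝ) + 1) * (((∫ z, (∫ y, Real.log (Literature.MathematicalPhysics.KineticTheory.localGibbsProfile a (u t) (θ t) y) ∂(Literature.Analysis.FluidPDE.empiricalMeasure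 z)) ∂(Literature.MathematicalPhysics.KineticTheory.localGibbsLaw σ a (u t) (θ t) N (Φ N))) - (∫ z, (∫ y, Real.log (Literature.MathematicalPhysics.KineticTheory.localGibbsProfile a (u t) (θ t) y) ∂(Literature.Analysis.FluidPDE.empiricalMeasure ((Φ N).flow t z))) ∂(Literature.MathematicalPhysics.KineticTheory.localGibbsLaw σ a₀ u₀ θ₀ N (Φ N)))) + C * ((N : ℝ) + 1) ^ (-(1 / 3 : ℝ)))) ∧ ENNReal.ofReal (((N : ℝ) + 1) * (((∫ z, (∫ y, Real.log (Literature.MathematicalPhysics.KineticTheory.localGibbsProfile a (u t) (θ t) y) ∂(Literature.Analysis.FluidPDE.empiricalMeasure z)) ∂(Literature.MathematicalPhysics.KineticTheory.localGibbsLaw σ a (u t) (θ t) N (Φ N))) - (∫ z, (∫ y, Real.log (Literature.MathematicalPhysics.KineticTheory.localGibbsProfile a (u t) (θ t) y) ∂(Literature.Analysis.FluidPDE.empiricalMeasure ((Φ N).flow t z))) ∂(Literature.MathematicalPhysics.KineticTheory.localGibbsLaw σ a₀ u₀ θ₀ N (Φ N)))) - C * ((N : ℝ) + 1) ^ (-(1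 / 3 : ℝ)))) ≤ InformationTheory.klDiv ((Φ N).lawAt (Literature.MathematicalPhysics.KineticTheory.localGibbsLaw σ a₀ u₀ θ₀ N (Φ N)) t) (Literature.MathematicalPhysics.KineticTheory.localGibbsLaw σ a (u t) (θ t) N (Φ N))

/-- item stmt-AtomisticToContinuum-14637 · support · rank 9 · open · by planner
sources: Spohn1991, KipnisLandim1999
[support] THE LAW SHARPENS THE BOUND (provable now; proved sorry-free in Sketch.lean, ~10 lines):
KnudsenRateLaw → MeanFieldKnudsenAccuracy. The two statements share the quantifier prefix and the
reference-activity clauses (positivity, probability, exponential concentration) verbatim; a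
convergent real sequence is bounded above (Filter.Tendsto.bddAbove_range), so (N+1)^(1/3)Θ^a_N(t) →
L gives B with Θ^a_N(t) ≤ B(N+1)^(-1/3) for all N (Real.rpow_neg, le_div_iff₀). Makes crux 4 an
entrance to X through KnudsenBandGlue. [deps: KnudsenRateLaw] [difficulty: provable-now] -/
@[route_item "route-AtomisticToContinuum-KnudsenRateHorizon"]
def MeanFieldOfRateLaw : Prop :=
  KnudsenRateLaw → MeanFieldKnudsenAccuracy

/-- item stmt-AtomisticToContinuum-17777 · support · rank 10 · open · by planner
sources: Yau1991, KipnisLandim1999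
[support] CRUX → TARGET GLUE of the re-typed route (re-type repair 2026-08-16; rank 10 so that it
renders after the rank-9 supports it quotes): MeanFieldKnudsenAccuracy → EntropySaturationKnudsen →
EntropyKnudsenRateInBand. PROVED sorry-free in the repair planner's Sketch.lean (theorem
knudsenBandGlueInBand_proof, axioms propext/Classical.choice/Quot.sound, against verbatim copies of
the rev-11 decls): η₀ := ηs (the band threshold of EntropySaturationKnudsen 14322), σ₀ := min of the
two σ₀'s (crux 3, 14322); for σ < σ₀, a solution with the Statement-shaped guard ρ_tσ³ < ηs on
[0,T), Φ: probability of the initial laws from crux 3; for t < T take the crux-3 witness a (a > 0,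
probability, concentration, Θ^a_N(t) ≤ C₁(N+1)^(−1/3)); the guard on [0,T) gives 14322's band on
[0,t] (s ≤ t < T); 14322 gives klDiv ≤ ofReal((N+1)(Θ^a_N + C₂(N+1)^(−1/3))) ≤
ofReal((C₁+C₂)(N+1)^(2/3)) (Real.rpow_add_one, nlinarith, ENNReal.ofReal_le_ofReal). Supersedes
KnudsenBandGlue 14616 (MeanFieldKnudsenAccuracy → EntropySaturationKnudsen → DiluteSelfConsistency →
X_old), dropped together with 3091: the band is a hypothesis of X now. [deps:
MeanFieldKnudsenAccuracy, EntropySaturationKnudsen] [difficulty: pr -/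
@[route_item "route-AtomisticToContinuum-KnudsenRateHorizon"]
def KnudsenBandGlueInBand : Prop :=
  MeanFieldKnudsenAccuracy → EntropySaturationKnudsen → EntropyKnudsenRateInBand

-- earlier Assembly (stmt-AtomisticToContinuum-12347, replaced 2026-08-15T21:16:31Z -> stmt-AtomisticToContinuum-13788): retired by None — EntropyKnudsenRate → KnudsenImpliesVanishing → EntropyToHydro → _root_.HydrodynamicLimit
-- earlier Assembly (stmt-AtomisticToContinuum-13788, replaced 2026-08-16T23:42:59Z -> stmt-AtomisticToContinuum-17880): retired by None — EntropyKnudsenRate → _root_.HydrodynamicLimit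
/-- item stmt-AtomisticToContinuum-17880 · assembly · rank 1 · open · by planner
sources: OllaVaradhanYau1993, KipnisLandim1999, Yau1991
[assembly] X → HydrodynamicLimit BY NAME (frame statement #1, restated 2026-08-16 by the re-type
repair from `EntropyKnudsenRate → _root_.HydrodynamicLimit`, 13788): the packing-guarded
Knudsen-rate entropy bound X = EntropyKnudsenRateInBand (target, rank 0) implies the re-typed
sub-problem Statement decl `_root_.HydrodynamicLimit`. TRUE via the shared guarded dock
EntropyToFieldsInBand (17397: RelEntropyVanishingInBand → _root_.HydrodynamicLimit, the landed
entropy-inequality step run inside the band) after the ENNReal squeeze X ⇒ RelEntropyVanishingInBand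
(same η₀, σ₀; klDiv ≤ ofReal(C(N+1)^(2/3)) ⇒ klDiv/(N+1) → 0), i.e. `fun h => closes h
EntropyToFieldsInBand_holds` once 17397 lands; NON-TRIVIAL in isolation (it carries the
entropy-inequality step), so it grounds. The deciding theorem is `closes (h₀ :
EntropyKnudsenRateInBand) (h₂ : EntropyToFieldsInBand) : _root_.HydrodynamicLimit` (Sketch2.lean rc
0, standard axioms). -/
@[route_item "route-AtomisticToContinuum-KnudsenRateHorizon"]
def Assembly : Prop :=
  EntropyKnudsenRateInBand → _root_.HydrodynamicLimit

-- records of items no longer active in this route (dropped / restated):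
-- earlier EntropyToHydro (stmt-AtomisticToContinuum-0769, dropped 2026-08-16T23:42:59Z): proved by Summit.AtomisticToContinuum.HydrodynamicLimit.Theorems.heatBathForgetting_assembly_proof @ 7068fd10e358 — RelEntropyVanishing → Literature.MathematicalPhysics.KineticTheory.HydrodynamicLimit
-- earlier KnudsenSaturationGlue (stmt-AtomisticToContinuum-14309, replaced 2026-08-16T03:27:54Z -> stmt-AtomisticToContinuum-14470): retired by None — MeanFieldKnudsenAccuracy → EntropySaturationKnudsen → HsEosLowDensity → DiluteSelfConsistency → KLFiniteness → EntropyKnudsenRate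

/-! D-0027 §2.1 — DECIDING THEOREM (planner-authored via `route open/edit --closes-file`; by planner-rrepair-AtomisticToContinuum-KnudsenRa-50332292-0 2026-08-16T23:44:16Z):
its hypotheses are this route's items and its conclusion the sub-problem Statement (glue_lint), and it elaborates with this file. -/

@[closes "route-AtomisticToContinuum-KnudsenRateHorizon"] theorem closes (h₀ : EntropyKnudsenRateInBand) (h₂ : EntropyToFieldsInBand) :
    _root_.HydrodynamicLimit := by
  -- Guarded re-base (route-repair 2026-08-16, Statement re-type p126922): the target X_g =
  -- EntropyKnudsenRateInBand carries the Statement's packing guard (∃ η₀ outermost), and the shared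
  -- guarded dock EntropyToFieldsInBand (stmt-17397: RelEntropyVanishingInBand → the re-typed conjunct
  -- BY NAME) consumes the guarded Yau form RelEntropyVanishingInBand (stmt-17396), derived here from
  -- h₀ with the same η₀ and σ₀ by the ENNReal squeeze
  -- klDiv ≤ ofReal (C (N+1)^(2/3)) ⟹ klDiv / (N+1) ≤ ofReal (max C 0 · (N+1)^(-1/3)) → 0.
  refine h₂ ?_
  obtain ⟨η₀, hη₀, h⟩ := h₀
  refine ⟨η₀, hη₀, fun a₀ θ₀ u₀ ha hθ hu ha0 hθ0 => ?_⟩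
  obtain ⟨σ₀, hσ₀, H⟩ := h a₀ θ₀ u₀ ha hθ hu ha0 hθ0
  refine ⟨σ₀, hσ₀, fun σ hσ hσ' T ρ θ u hsol hg Φ => ?_⟩
  obtain ⟨hprob, H⟩ := H σ hσ hσ' T ρ θ u hsol hg Φ
  refine ⟨hprob, fun hinit t ht => ?_⟩
  obtain ⟨a, haprob, hconc, C, hC⟩ := H hinit t ht
  refine ⟨a, haprob, hconc, ?_⟩
  have hlim : Filter.Tendsto (fun N : ℕ => ENNReal.ofReal (max C 0 * ((N : ℝ) + 1) ^ (-(1 / 3 : ℝ))))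
      Filter.atTop (nhds 0) := by
    have h1 : Filter.Tendsto (fun N : ℕ => (N : ℝ) + 1) Filter.atTop Filter.atTop :=
      Filter.tendsto_atTop_add_const_right _ _ tendsto_natCast_atTop_atTop
    have h2 : Filter.Tendsto (fun N : ℕ => ((N : ℝ) + 1) ^ (-(1 / 3 : ℝ))) Filter.atTop (nhds 0) :=
      (tendsto_rpow_neg_atTop (by norm_num : (0 : ℝ) < 1 / 3)).comp h1
    have h3 := ENNReal.tendsto_ofReal (h2.const_mul (max C 0))
    simpa using h3
  refine tendsto_of_tendsto_of_tendsto_of_le_of_le tendsto_const_nhds hlim (fun N => zero_le)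
    (fun N => ?_)
  have hN : (0 : ℝ) < (N : ℝ) + 1 := by positivity
  have hcast : ((N : ENNReal) + 1) = ENNReal.ofReal ((N : ℝ) + 1) := by
    rw [ENNReal.ofReal_add (Nat.cast_nonneg N) zero_le_one, ENNReal.ofReal_natCast, ENNReal.ofReal_one]
  have hreal : C * ((N : ℝ) + 1) ^ (2 / 3 : ℝ) / ((N : ℝ) + 1) ≤ max C 0 * ((N : ℝ) + 1) ^ (-(1 / 3 : ℝ)) := by
    have hpow : ((N : ℝ) + 1) ^ (2 / 3 : ℝ) / ((N : ℝ) + 1) = ((N : ℝ) + 1) ^ (-(1 / 3 : ℝ)) := by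
      rw [← Real.rpow_sub_one hN.ne']
      norm_num
    rw [mul_div_assoc, hpow]
    exact mul_le_mul_of_nonneg_right (le_max_left _ _) (Real.rpow_nonneg hN.le _)
  calc InformationTheory.klDiv ((Φ N).lawAt (Literature.MathematicalPhysics.KineticTheory.localGibbsLaw σ a₀ u₀ θ₀ N (Φ N)) t)
          (Literature.MathematicalPhysics.KineticTheory.localGibbsLaw σ a (u t) (θ t) N (Φ N)) / ((N : ENNReal) + 1)
        ≤ ENNReal.ofReal (C * ((N : ℝ) + 1) ^ (2 / 3 : ℝ)) / ((N : ENNReal) + 1) :=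
          ENNReal.div_le_div_right (hC N) _
    _ = ENNReal.ofReal (C * ((N : ℝ) + 1) ^ (2 / 3 : ℝ) / ((N : ℝ) + 1)) := by
          rw [hcast, ENNReal.ofReal_div_of_pos hN]
    _ ≤ ENNReal.ofReal (max C 0 * ((N : ℝ) + 1) ^ (-(1 / 3 : ℝ))) := ENNReal.ofReal_le_ofReal hreal

end Summit.AtomisticToContinuum.HydrodynamicLimit.Theses.KnudsenRateHorizon
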